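import Literature.MathematicalPhysics.KineticTheory.FouriersLaw
import Literature.MathematicalPhysics.KineticTheory.LangevinChainGibbs
import Literature.MathematicalPhysics.KineticTheory.LangevinChainKernel

/-!
# Crux `StieltjesRepresentation` (stmt-AtomisticToContinuum-15248) — ideator 5 (g2), round 2: first lemmas

Both cards act on the φ⁴ edge `stub_phi4Edge` (`β = 0 < lam`, chain `pinnedChain ω₂ lam 0 γ`) of the
crux (kernel fact `CayleyPencil.stieltjesRepresentation_iff_phi4Edge`, p167063): the NESS linear
response of the total current must be shown to EXIST and to EQUAL the (Abel-regularised) equilibrium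
Green–Kubo / pencil value, for every fixed `N ≥ 2`, from weak existence + uniqueness of steady states
only.  Nothing here is proved; these are the first checkable statements of the two lines, typed over
existing declarations (`OscillatorChain.generator/IsSteadyState/totalCurrent/bondCurrent/hamiltonian/
gibbsMeasure/transitionKernel`, `pinnedChain`, `partialP`).

* Card A `abel-tight-response` (SOFT IDENTIFICATION): `LinearisedUniqueness` (the stub's own
  uniqueness hypothesis at `(T,T)` forces uniqueness of the first-order response measure — Kato
  splitting), `AbelPairing` (finite-`δ` Abel identity obtained by testing weak stationarity with the
  equilibrium `η`-resolvent), the residual `ResponseTightness` (weighted-TV `O(δ)` stability of the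
  NESS family — the ONLY quantitative input), and the transfer `SoftIdentification :
  ResponseTightness ⇒ AbelKubo` (response exists and equals the Abel–Green–Kubo value, whose
  `η → 0⁺` limit exists as a by-product).
* Card B `passivity-golden-rule` (ENGINE for the residual): `BathRoughnessIndex` (integrator
  counting: the `(2j+1)`-st Liouville derivative of `q_j` is the first to see the bath momentum `p₀`,
  with coefficient exactly `1` for harmonic coupling — the structural origin of the universal spectral
  tail `S_{q_j}(Ω) ≍ 2γT/Ω^{4j+4}` and of the Hairer–Mattingly exponent `1 - n`), and the target
  `GradedLeakLaw` (a TIME-INTEGRATED, state-dependent-window energy drift: from energy `E` the mean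
  energy drops by `1` within time `K·E^{d⋆-1}`, `d⋆ = ⌊(N-1)/2⌋`, uniformly for bath temperatures
  near `T`; pointwise generator drifts for functions of `H` are excluded by
  `StrongPinningBreathersNarrow` (iii), time-integrated ones are not).
-/

noncomputable section

open MeasureTheory Set Filter Topology
open scoped NNReal ContDiff

namespace Summit.AtomisticToContinuum.FouriersLaw.Cruxes.StieltjesRepresentation.IdeasK5g2

open Literature.MathematicalPhysics.KineticTheory.HeatConduction

/-- The φ⁴ chain at the edge of the crux's parameter range: pinning `ω₂ q²/2 + lam q⁴/4`,
HARMONIC coupling (`β = 0`), bath friction `γ`. -/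
abbrev phi4 (ω₂ lam γ : ℝ) : OscillatorChain := pinnedChain ω₂ lam 0 γ

/-- The kinetic-temperature imbalance of the two contact momenta, `u = p₀² - p_{N-1}²`
(the McLennan source is `γ u /(2T²)`; `u = 0` when `N = 1`). -/
def bathImbalance (N : ℕ) (z : PhaseSpace N) : ℝ :=
  ∑ i : Fin N, ((if i.val = 0 then z.2 i ^ 2 else 0) - (if i.val = N - 1 then z.2 i ^ 2 else 0))

/-- The total-current observable `J = ∑_i j_i`, so that `P.totalCurrent μ = ∫ J dμ` when the bond
currents are integrable. -/
def totalCurrentFn (P : OscillatorChain) (N : ℕ) (z : PhaseSpace N) : ℝ :=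
  ∑ i : Fin N, P.bondCurrent N i z

/-- The equilibrium `η`-resolvent of an observable `ψ` for the φ⁴ chain with BOTH baths at `T`:
`w_η = R_η ψ = ∫₀^∞ e^{-ηt} P^{T,T}_t ψ dt` (constructed transition kernels; for bounded `ψ`,
`|w_η| ≤ ‖ψ‖_∞/η`). No `η = 0` object (Poisson solution / corrector) is ever formed. -/
def resolvent (ω₂ lam γ T : ℝ) (N : ℕ) (η : ℝ) (ψ : PhaseSpace N → ℝ) (z : PhaseSpace N) : ℝ :=
  ∫ t in Ioi (0 : ℝ), Real.exp (-η * t) *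
    ∫ y, ψ y ∂((phi4 ω₂ lam γ).transitionKernel N T T t.toNNReal z)

/-! ### Card A — `abel-tight-response` -/

/-- **Card A, first lemma (a): linearised uniqueness from the stub's uniqueness hypothesis.**
If weak steady states of the φ⁴ chain at EQUAL bath temperatures `(T,T)` are unique, then the weak
stationary equation `L_{T,T}^* ρ = 0` has no non-trivial SIGNED solution of zero mass with a finite
first energy moment: two finite measures with equal mass, finite `∫ H`, and equal pairings
`∫ L_{T,T} f dρ₁ = ∫ L_{T,T} f dρ₂` on `C_c^∞` coincide.  (Proof idea: `ρ = ρ₁ - ρ₂` has a smooth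
density `h` by hypoellipticity; Kato's inequality along the noised directions makes `h⁺` a
sub-solution, `L^* h⁺ = κ ≥ 0`; testing against cut-offs `f_R → 1` with the `H`-moment kills `κ`;
so `h^± dx` are weak steady states and uniqueness gives `h⁺ dx ∝ μ_T ∝ h⁻ dx`, equal masses ⇒ `h = 0`.)
Consequence: every limit point of the response family `(μ_δ - μ_T)/δ` is THE solution of the
linearised Kolmogorov equation `L_{T,T}^* ν = -B^* μ_T`, `B = (γ/2)(∂²_{p₀} - ∂²_{p_{N-1}})`. -/
def LinearisedUniqueness (ω₂ lam γ T : ℝ) (N : ℕ) : Prop :=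
  (∀ μ ν : Measure (PhaseSpace N),
      (phi4 ω₂ lam γ).IsSteadyState N T T μ → (phi4 ω₂ lam γ).IsSteadyState N T T ν → μ = ν) →
    ∀ ρ₁ ρ₂ : Measure (PhaseSpace N), IsFiniteMeasure ρ₁ → IsFiniteMeasure ρ₂ →
      Integrable ((phi4 ω₂ lam γ).hamiltonian N) ρ₁ → Integrable ((phi4 ω₂ lam γ).hamiltonian N) ρ₂ →
      ρ₁ univ = ρ₂ univ →
      (∀ f : PhaseSpace N → ℝ, ContDiff ℝ ∞ f → HasCompactSupport f →
          ∫ z, (phi4 ω₂ lam γ).generator N T T f z ∂ρ₁ = ∫ z, (phi4 ω₂ lam γ).generator N T T f z ∂ρ₂) →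
      ρ₁ = ρ₂

/-- **Card A, first lemma (b): the finite-`δ` Abel pairing.** Weak stationarity of a steady state `μ`
at bath temperatures `(T_L, T_R)` extends from `C_c^∞` to the equilibrium resolvent class: for
`ψ ∈ C_c^∞`, `η > 0` and `w_η = R_η ψ` (smooth, bounded, with `L_{T,T} w_η = η w_η - ψ` pointwise),
`η μ(w_η) - μ(ψ) + μ((L_{T_L,T_R} - L_{T,T}) w_η) = 0`, where
`(L_{T_L,T_R} - L_{T,T}) w = γ (T_L - T) ∂²_{p₀} w + γ (T_R - T) ∂²_{p_{N-1}} w`.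
At `T_L = T + δ/2`, `T_R = T - δ/2` and after subtracting the `δ = 0` instance (`μ_T`):
`ν_δ(ψ) = η ν_δ(w_η) + μ_δ(B w_η)` with `ν_δ = (μ_δ - μ_T)/δ` — response paired against a
bounded `η > 0` object only. -/
def AbelPairing (ω₂ lam γ T : ℝ) (N : ℕ) : Prop :=
  ∀ η : ℝ, 0 < η →
    ∀ ψ : PhaseSpace N → ℝ, ContDiff ℝ ∞ ψ → HasCompactSupport ψ →
      ∀ T_L T_R : ℝ, 0 < T_L → 0 < T_R →
        ∀ μ : Measure (PhaseSpace N), (phi4 ω₂ lam γ).IsSteadyState N T_L T_R μ →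
          Integrable (resolvent ω₂ lam γ T N η ψ) μ ∧
          Integrable (fun z => (phi4 ω₂ lam γ).generator N T_L T_R (resolvent ω₂ lam γ T N η ψ) z -
              (phi4 ω₂ lam γ).generator N T T (resolvent ω₂ lam γ T N η ψ) z) μ ∧
          η * (∫ z, resolvent ω₂ lam γ T N η ψ z ∂μ) - (∫ z, ψ z ∂μ) +
              ∫ z, ((phi4 ω₂ lam γ).generator N T_L T_R (resolvent ω₂ lam γ T N η ψ) z -
                (phi4 ω₂ lam γ).generator N T T (resolvent ω₂ lam γ T N η ψ) z) ∂μ = 0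

/-- **Card A, the residual `(H1*)`: response tightness** (weighted total-variation Lipschitz
stability of the two-temperature NESS family at `δ = 0`, weight `(1 + H)^m`): there are `C, δ₀` with
`|μ_δ(φ) - μ_T(φ)| ≤ C |δ|` for all `0 < |δ| ≤ δ₀`, every steady state `μ_δ` at `(T + δ/2, T - δ/2)`
and every MEASURABLE `|φ| ≤ (1+H)^m` (so: a TV-type bound, indicator observables included).
The `β > 0` exponential-weight analogue is the tree's `ness_gibbs_integral_sub_le` (proved from
`δ`-uniform Harris constants); at `β = 0` it is the canonical output of a weighted POLYNOMIAL
(subgeometric) Harris theorem + `O(δ)` closeness of the one-step kernels (finite-time hypoelliptic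
estimates) — no Poisson-equation derivative bounds. For `N ≥ 4` it implies existence of the
`β = 0` steady state (open: Hairer–Mattingly 2009 §1), i.e. it is the dynamical content. -/
def ResponseTightness (ω₂ lam γ T : ℝ) (N m : ℕ) : Prop :=
  ∃ C δ₀ : ℝ, 0 < δ₀ ∧ δ₀ < T ∧
    ∀ δ : ℝ, δ ≠ 0 → |δ| ≤ δ₀ →
      ∀ μ : Measure (PhaseSpace N), (phi4 ω₂ lam γ).IsSteadyState N (T + δ / 2) (T - δ / 2) μ →
        ∀ φ : PhaseSpace N → ℝ, Measurable φ →
          (∀ z, |φ z| ≤ (1 + (phi4 ω₂ lam γ).hamiltonian N z) ^ m) →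
          Integrable φ μ ∧
            |(∫ z, φ z ∂μ) - ∫ z, φ z ∂((phi4 ω₂ lam γ).gibbsMeasure N T)| ≤ C * |δ|

/-- **Card A, output: the Abel–Kubo formula at the φ⁴ edge.** Along every steady-state family the
linear response `D_N` of the total current EXISTS and equals the `η → 0⁺` limit — which also exists —
of the Abel-regularised Green–Kubo cross-correlation
`(γ/2T²) ∫ u · R_η J dμ_T = (γ/2T²) ∫₀^∞ e^{-ηt} μ_T(u · P_t J) dt` (`u = p₀² - p²_{N-1}`,
`J = ∑ j_i`).  The round-1 engines (accretive pencil ⇒ `γ ×` Stieltjes with `η`-uniform mass;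
Stieltjes class closed) then turn `D_N(γ)` into the crux's `(N-1) γ ∫ Φ_N · 2t/(γ²+t²)²`. -/
def AbelKubo (ω₂ lam γ T : ℝ) (N : ℕ) : Prop :=
  ∀ μ : ℝ → ℝ → Measure (PhaseSpace N),
    (∀ T_L T_R : ℝ, 0 < T_L → 0 < T_R → (phi4 ω₂ lam γ).IsSteadyState N T_L T_R (μ T_L T_R)) →
      ∃ D : ℝ,
        Tendsto (fun η : ℝ => γ / (2 * T ^ 2) *
            ∫ z, bathImbalance N z * resolvent ω₂ lam γ T N η (totalCurrentFn (phi4 ω₂ lam γ) N) z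
              ∂((phi4 ω₂ lam γ).gibbsMeasure N T))
          (𝓝[>] 0) (𝓝 D) ∧
        Tendsto (fun δ : ℝ => (phi4 ω₂ lam γ).totalCurrent (μ (T + δ / 2) (T - δ / 2)) / δ)
          (𝓝[≠] 0) (𝓝 D)

/-- **Card A, transfer (the line's theorem): soft identification.** Under the stub's own weak-NESS
uniqueness hypothesis (all bath temperatures), response tightness ALONE identifies the response:
`ResponseTightness ⇒ AbelKubo`.  (The proof uses one explicit `m = m₀(N)` — the polynomial weight
dominating `∂²_{p_b} w_η` — not all `m`; compactness of `ν_δ`, `LinearisedUniqueness` for the limit,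
`AbelPairing` on the limit, von Neumann's mean ergodic theorem for `η w_η → μ_T(ψ)` in
`μ_T`-measure (ergodicity of `μ_T` ⇐ uniqueness at `(T,T)`), Gaussian integration by parts
`μ_T(B w) = (γ/2T²) μ_T(u w)`, truncation of `J` by the `H₋₁`/Fisher bound.) -/
def SoftIdentification : Prop :=
  ∀ ω₂ lam γ T : ℝ, 0 < ω₂ → 0 < lam → 0 < γ → 0 < T → ∀ N : ℕ, 2 ≤ N →
    (∀ (T_L T_R : ℝ), 0 < T_L → 0 < T_R → ∀ μ ν : Measure (PhaseSpace N),
        (phi4 ω₂ lam γ).IsSteadyState N T_L T_R μ → (phi4 ω₂ lam γ).IsSteadyState N T_L T_R ν →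
          μ = ν) →
      (∀ m : ℕ, ResponseTightness ω₂ lam γ T N m) →
        AbelKubo ω₂ lam γ T N

/-! ### Card B — `passivity-golden-rule` -/

/-- The Liouville operator `A = {·, H}` of the φ⁴ chain, obtained from the tree's `generator` by
switching the baths off (`γ = 0`; the Hamiltonian does not involve `γ`). -/
def liouville (ω₂ lam : ℝ) (N : ℕ) : (PhaseSpace N → ℝ) → PhaseSpace N → ℝ :=
  (pinnedChain ω₂ lam 0 0).generator N 0 0

/-- Depth of the most central site of an `N`-site chain with baths at both ends (Hairer–Mattingly's
`n`): `d⋆ = ⌊(N-1)/2⌋`. -/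
def dstar (N : ℕ) : ℕ := (N - 1) / 2

/-- **Card B, first lemma: the bath-roughness index (integrator counting).** Along the Hamiltonian
flow the iterated derivatives `A^k q_j`, `k ≤ 2j`, do not involve the left contact momentum `p₀`, and
`A^{2j+1} q_j = p₀ + (terms free of p₀)`: the unique shortest path from `q_j` to `p₀` crosses `j`
harmonic bonds (`V'' ≡ 1`).  With the bath on, `q_j^{(2j)}` is `C¹` and `q_j^{(2j+1)}` is an Itô
process with diffusion coefficient EXACTLY `√(2γT_L)` — whence the universal high-frequency tail
`S_{q_j}(Ω) ≍ 2γT_L/Ω^{4j+4}` of every stationary spectral density and, by the fluctuation–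
dissipation theorem for the severed sub-chain, the golden-rule leak exponent `P ≍ E^{1-n}` of a
breather at depth `n` (`= ` Hairer–Mattingly's `γ(2,n) = 1 - n`). Purely algebraic, any pinning. -/
def BathRoughnessIndex : Prop :=
  ∀ ω₂ lam : ℝ, ∀ N : ℕ, ∀ j b : Fin N, b.val = 0 →
    (∀ k : ℕ, k ≤ 2 * j.val →
        ∀ z, partialP b ((liouville ω₂ lam N)^[k] (fun x : PhaseSpace N => x.1 j)) z = 0) ∧
      ∀ z, partialP b ((liouville ω₂ lam N)^[2 * j.val + 1] (fun x : PhaseSpace N => x.1 j)) z = 1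

/-- **Card B, target: the graded leak law** (time-integrated, state-dependent-window energy drift,
uniform in the bath temperatures near `T`): there are `K, E₀, δ₀` such that from EVERY state of energy
`H(z) ≥ E₀` the mean energy after time `K · H(z)^{d⋆-1}` has dropped by at least `1`.  (Second
law/passivity gives the SIGN of the breather's mean work on each severed sub-chain; the golden rule
`P = ½ A² Ω · Im χ_rest(Ω)` with `Im χ = Ω S/2T` and the universal tail gives the MAGNITUDE
`≳ E^{1-d⋆}`; `K` absorbs the `O(1)` transient heating of cold contact sites.)  A Meyn–Tweedie
state-dependent drift ⇒ polynomial weighted Harris ⇒ `ResponseTightness` (Card A). The window is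
`E`-dependent because `L(F∘H)(q,0) ≥ 0` forbids pointwise drifts (`StrongPinningBreathersNarrow`). -/
def GradedLeakLaw (ω₂ lam γ T : ℝ) (N : ℕ) : Prop :=
  ∃ K E₀ δ₀ : ℝ, 0 < K ∧ 0 < E₀ ∧ 0 < δ₀ ∧ δ₀ < T ∧
    ∀ T_L T_R : ℝ, |T_L - T| ≤ δ₀ → |T_R - T| ≤ δ₀ →
      ∀ z : PhaseSpace N, E₀ ≤ (phi4 ω₂ lam γ).hamiltonian N z →
        Integrable ((phi4 ω₂ lam γ).hamiltonian N)
            ((phi4 ω₂ lam γ).transitionKernel N T_L T_R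
              (K * (phi4 ω₂ lam γ).hamiltonian N z ^ ((dstar N : ℝ) - 1)).toNNReal z) ∧
          ∫ y, (phi4 ω₂ lam γ).hamiltonian N y
              ∂((phi4 ω₂ lam γ).transitionKernel N T_L T_R
                (K * (phi4 ω₂ lam γ).hamiltonian N z ^ ((dstar N : ℝ) - 1)).toNNReal z) ≤
            (phi4 ω₂ lam γ).hamiltonian N z - 1

/-- **Card B ⇒ Card A (the engine feeds the residual).** -/
def LeakLawGivesTightness : Prop :=
  ∀ ω₂ lam γ T : ℝ, 0 < ω₂ → 0 < lam → 0 < γ → 0 < T → ∀ N : ℕ, 2 ≤ N →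
    GradedLeakLaw ω₂ lam γ T N → ∀ m : ℕ, ResponseTightness ω₂ lam γ T N m

end Summit.AtomisticToContinuum.FouriersLaw.Cruxes.StieltjesRepresentation.IdeasK5g2

end
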